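import Summits.QuantumFields.BalabanUV.Beta.EriceRemainderEnclosureHistoryAutonomyComparisonLoadBudgetLevels
import Summits.QuantumFields.BalabanUV.Beta.EriceRemainderEnclosureHistoryAutonomyComparisonAgeCompositionIdentificationEnd
import Summits.QuantumFields.BalabanUV.Beta.EriceRemainderEnclosureHistoryAutonomyComparisonAgeCompositionStaticChainClosure

/-!
# EriceRemainderEnclosureHistoryAutonomyComparisonAgeCompositionStaticChainClosureAtPin — (E80c) THE IDENTIFICATION: at every pin of every box solution the
# budget loads are a LEVEL-COUPLED FEASIBLE configuration (levels `(h_m∕h_{m+k})²`), so by (E80b) `lc_static_closure` **THE FLOW'S WINDOW-MASS STATIC CHAIN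
# CLOSES AT EVERY PIN** — for the flow's own first-order data (damped young loads, old mass in the young window, persistence defects) and for any dominated data

Cell `pub-balaban`, β-function sub-cell, BINDER row D4 «RemainderConst leaves for Bałaban's split» (`HOME/BINDER-OWNERS.md`; owner lineage `b2b-balaban-beta-an4`;
this file by co-owner #2 lineage `b2b-balaban-beta-d4-p2`, generation 71), β-FLOW TEAM duty (1), FREEZE (0) honoured (def-free; imports (E76b) `…LoadBudgetLevels`,
(E75b) `…AgeCompositionIdentificationEnd` (hence (E75a)), (E80b) `…StaticChainClosure`; nothing restated).

HONEST FRAMING (page 1, verbatim and binding).  *"Discharging BetaPertH makes Bałaban's UV stability UNCONDITIONAL — a real constructive-QFT result; it is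
NOT the continuum limit and NOT the Clay problem."*  THIS FILE DISCHARGES NOTHING OF THE KIND.  Elementary real algebra over the cell's own binders `SeqBox`,
`MemFlow` and the hypothesis shape «isotone memory with floor dominated by a profile `L`» — hypotheses of a census, not facts; the age profile of Bałaban's
(1.22) limit functional is NOT PRINTED ([I] p. 298; GAPS G-t4-U2-1∕-2) and NOT asserted.  Row D4 class UNCHANGED (critical-path width 0; instance 0∕1; D4
DISCHARGE NO DATE).  HONEST DEPENDENCY: continuum YM on T⁴ ⇐ BetaPertH ∧ nine spine estimates (0/9 proved); BetaPertH ⇐ (D1) ∧ (D4) ∧ CAP+tail; G-an2-4 gates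
asym, D1 and NE2/3/4.

THE POINT (census sense (α); routes (N)∕(N′) of READMEs `g62/e71` … `g70/e79`; this station `HOME/b2b-balaban-beta-d4-p2/g71/e80/README.md`).  Route (N) reads:
first-order (E58′) for a finite profile ⟸ [the static chain closes at every pin] ∧ MONO ∧ MONO′ ((E71b)–(E71d), (E75a)∕(E75b)); route (N′) runs the chain over the
LEVEL-COUPLED system instead of (E65a)'s polytope ((E76b)), and (E80b) `lc_static_closure` proved: over EVERY level-coupled feasible configuration the window-mass
chain closes, for every dominated data.  THIS FILE puts the flow in: §1 **`lc_feasible_at_pin`** — at the pin `m`, with the ages enumerated oldest first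
(`k_i = K − 1 − i`) and the budget loads `x_i = L_{k_i}k_ih_{m+k_i}³∕2`, the levels `a_i = (h_m∕h_{m+k_i})²` satisfy the level-coupled rows `a_i ≥ 1 +
Σ_l(2x_lS(k_l,k_i)∕k_l)a_l` ((E76b) `load_budget_levels_at_pin` on the window `[0,k_i)`, times `a_i`); §2 **`static_chain_closes_at_pin`** (any chain data
dominated by the budget data: `x̃ ≤ x`, `θ ≤ θ̄(k_l∕k_i)`, `Ω ≤ Σ_{l<i}x_lk_i∕k_l`) and **`flow_static_chain_closes_at_pin`**: THE FLOW'S OWN CHAIN — young damped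
load `x̃ = Σ_lKy_{m,l}`, old mass in the young window `Ω_m = Σ_{kk}Σ_{l<y}E_{kk,m,l}`, defects `θ̂_k(m;y)` in the letters of (E75a)∕(E75b), for every young age
`y = k_i` — has `0 ≤ ρ_i < 1` at every step, by the orderings (E75a) `young_load_le`, `window_mass_le_undamped`, (E75b) `defect_le_thetabar`.  So «THE STATIC
CHAIN CLOSES AT EVERY PIN» — the static half of route (N) at first order (README g62∕e71 §PS: conjectured with `sup ρ ≈ 0.55`; g67–g70: over the level-coupled
system) — IS A TREE THEOREM ABOUT EVERY BOX SOLUTION.  WHAT REMAINS of route (N) at first order: the wiring «closure ⇒ the carried ratios bound the drop ratios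
((E71d) `surplus_sandwich`∕`drop_ratio_step`, needs MONO′) ⇒ `hstar` of (E75b) `key_at_pin_of_window_mass_ineq` ⇒ KEY at every age ⇒ (E71b)», and MONO∕MONO′
themselves; then the nonlinear route (N).  NOT CLAIMED: KEY; MONO∕MONO′; (E58′); anything nonlinear; anything printed.

WHAT IS PROVED ([folklore]; 0 `def`, 0 sorry).  §1 **`lc_feasible_at_pin`**.  §2 **`static_chain_closes_at_pin`**, `sum_older_eq_sum_steps`,
**`flow_static_chain_closes_at_pin`**.  §3 (append, same generation) `window_mass_lt_one_at_pin`, **`flow_window_mass_lt_one_at_pin`** (`Ω_m < 1`).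
-/
noncomputable section
open Finset

namespace Summit.QuantumFields.BalabanUV.Beta.EriceRemainderEnclosureHistoryAutonomyComparisonAgeCompositionStaticChainClosureAtPin

open Literature.MathematicalPhysics.QuantumFieldTheory.Balaban1983to89
open Literature.MathematicalPhysics.QuantumFieldTheory.Balaban1983to89.T4BetaStationary
open Literature.MathematicalPhysics.QuantumFieldTheory.Balaban1983to89.T4BetaFlowWellPosed
open Summit.QuantumFields.BalabanUV.Beta.EriceRemainderEnclosureHistoryAutonomyOrder (strictAnti_of_memFlow)
open Summit.QuantumFields.BalabanUV.Beta.EriceRemainderEnclosureHistoryAutonomyComparisonLoadBudgetWindow (readWindow_nonneg)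
open Summit.QuantumFields.BalabanUV.Beta.EriceRemainderEnclosureHistoryAutonomyComparisonLoadBudgetLevels (load_budget_levels_at_pin)
open Summit.QuantumFields.BalabanUV.Beta.EriceRemainderEnclosureHistoryAutonomyComparisonAgeCompositionIdentification
open Summit.QuantumFields.BalabanUV.Beta.EriceRemainderEnclosureHistoryAutonomyComparisonAgeCompositionIdentificationEnd (defect_le_thetabar)
open Summit.QuantumFields.BalabanUV.Beta.EriceRemainderEnclosureHistoryAutonomyComparisonAgeCompositionStaticChainClosure (lc_static_closure lc_window_mass_lt_one)

variable {B : (ℕ → ℝ) → ℝ} {γ b gIR : ℝ} {L : ℕ → ℝ} {K : ℕ} {h g : ℕ → ℝ}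

/-! ## §1 The loads of a flow at a pin are a level-coupled feasible configuration -/

/-- **LEVEL-COUPLED FEASIBILITY AT EVERY PIN.**  `B` isotone with floor `b > 0` dominated by `L ≥ 0` on the ages `< K`, `h` a box solution from the pin
`gIR`; pin `m`; the ages enumerated OLDEST FIRST, `k_i = K − 1 − i` (`i < K − 1`), with the budget loads `x_i = L_{k_i}·k_i·h_{m+k_i}³∕2`.  Then the
levels `a_i = (h_m∕h_{m+k_i})²` are positive and satisfy the LEVEL-COUPLED rows `a_i ≥ 1 + Σ_l (2x_l·S(k_l,k_i)∕k_l)·a_l` — (E76b) `load_budget_levels_at_pin`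
on the window `[0, k_i)`, multiplied by `a_i`, the scale `0` carrying no load.  This is the hypothesis `hfeas` of (E80b) `lc_static_closure`. [folklore] -/
theorem lc_feasible_at_pin (hmono : ∀ u v : ℕ → ℝ, SeqBox γ u → SeqBox γ v → (∀ j, u j ≤ v j) → B u ≤ B v)
    (hL : ∀ k, 0 ≤ L k) (hb : 0 < b) (hlo : ∀ u, SeqBox γ u → b ≤ B u) (hdom : ∀ u, SeqBox γ u → ∑ k ∈ range K, L k * u k ≤ B u)
    (hh : SeqBox γ h) (hf : MemFlow B gIR h) (m : ℕ) {k : ℕ → ℕ} {x : ℕ → ℝ}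
    (hk : ∀ i, i < K - 1 → k i = K - 1 - i) (hx : ∀ i, i < K - 1 → x i = L (k i) * (k i) * h (m + k i) ^ 3 / 2) :
    ∃ a : ℕ → ℝ, (∀ i, i < K - 1 → 0 < a i) ∧
      ∀ i, i < K - 1 → 1 + ∑ l ∈ range (K - 1),
        (2 * x l * (∑ t ∈ range (k i), Real.sqrt ((k l : ℝ) / ((k l : ℝ) + t + 1))) / (k l : ℝ)) * a l ≤ a i := by
  have hp : ∀ n, 0 < h n := fun n => (hh n).1
  refine ⟨fun i => (h m / h (m + k i)) ^ 2, fun i _ => pow_pos (div_pos (hp _) (hp _)) 2, ?_⟩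
  intro i hi
  obtain ⟨K', hK'⟩ : ∃ K', K = K' + 1 := ⟨K - 1, by omega⟩
  have hK1 : K - 1 = K' := by omega
  -- the level-coupled row of the scale `j = k i` at the pin, window `[0, j)`
  have hrow := load_budget_levels_at_pin hmono hL hb hlo hdom hh hf m (Nat.zero_le (k i))
  simp only [← range_eq_Ico, Nat.add_zero] at hrow
  set F : ℕ → ℝ := fun kk => L kk * kk * h (m + kk) ^ 3 * ((h (m + k i) / h (m + kk)) ^ 2 *
    ((∑ t ∈ range (k i), Real.sqrt ((kk : ℝ) / ((kk : ℝ) + t + 1))) / kk)) with hF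
  -- re-enumerate the scales `kk < K` as `kk = K − 1 − l`, `l < K`; the scale `0` (`l = K − 1`) carries nothing
  have hrefl : ∑ kk ∈ range K, F kk = ∑ l ∈ range (K - 1), F (k l) := by
    rw [← sum_range_reflect F K, hK', Nat.add_sub_cancel, sum_range_succ, Nat.sub_self]
    have h0 : F 0 = 0 := by rw [hF]; simp
    rw [h0, add_zero]
    exact sum_congr rfl fun l hl => by rw [hk l (by have := mem_range.mp hl; omega)]; congr 1; omega
  rw [hrefl] at hrow
  -- multiply by the level `a_i = (h_m ∕ h_{m+k_i})² > 0`
  set lev : ℝ := (h m / h (m + k i)) ^ 2 with hlev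
  have hlev0 : 0 < lev := pow_pos (div_pos (hp _) (hp _)) 2
  have hone : lev * (h (m + k i) / h m) ^ 2 = 1 := by
    rw [hlev, ← mul_pow, div_mul_div_comm, mul_comm (h m), div_self (mul_ne_zero (hp _).ne' (hp _).ne'), one_pow]
  have hterm : ∀ l, l < K - 1 → lev * F (k l) =
      (2 * x l * (∑ t ∈ range (k i), Real.sqrt ((k l : ℝ) / ((k l : ℝ) + t + 1))) / (k l : ℝ)) * (h m / h (m + k l)) ^ 2 := by
    intro l hl
    rw [hx l hl, hF, hlev]
    have e : (h m / h (m + k i)) ^ 2 * (h (m + k i) / h (m + k l)) ^ 2 = (h m / h (m + k l)) ^ 2 := by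
      rw [← mul_pow]; congr 1; field_simp [(hp (m + k i)).ne', (hp (m + k l)).ne']
    calc (h m / h (m + k i)) ^ 2 * (L (k l) * (k l) * h (m + k l) ^ 3 * ((h (m + k i) / h (m + k l)) ^ 2 *
          ((∑ t ∈ range (k i), Real.sqrt ((k l : ℝ) / ((k l : ℝ) + t + 1))) / (k l))))
        = ((h m / h (m + k i)) ^ 2 * (h (m + k i) / h (m + k l)) ^ 2) * (L (k l) * (k l) * h (m + k l) ^ 3 *
          ((∑ t ∈ range (k i), Real.sqrt ((k l : ℝ) / ((k l : ℝ) + t + 1))) / (k l))) := by ring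
      _ = _ := by rw [e]; ring
  have hmul := mul_le_mul_of_nonneg_left hrow hlev0.le
  rw [mul_sum, mul_sub, mul_one, hone] at hmul
  rw [sum_congr rfl fun l hl => hterm l (mem_range.mp hl)] at hmul
  beta_reduce
  linarith

/-! ## §2 The static chain closes at every pin: dominated data, and the flow's own data -/

/-- **THE WINDOW-MASS STATIC CHAIN CLOSES AT EVERY PIN — dominated data.**  Same flow; pin `m`; ages oldest first `k_i = K − 1 − i`, budget loads
`x_i = L_{k_i}k_ih_{m+k_i}³∕2`.  ANY static chain `ρ_i = x̃_i(1 + Σ_{l<i}θ_{i,l}b_{i,l})∕(1 − Ω_i)` ((E72a): `b_{i+1,i} = ρ_i∕(1−ρ_i)`, `b_{i+1,l} = b_{i,l}∕(1−ρ_i)`)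
whose data are dominated by the flow's budget data — `0 ≤ x̃_i ≤ x_i`, `0 ≤ θ_{i,l} ≤ θ̄(k_l∕k_i)`, `Ω_i ≤ Σ_{l<i} x_lk_i∕k_l` — CLOSES: `0 ≤ ρ_i < 1` for every
`i < K − 1`.  (§1 + (E80b) `lc_static_closure`.) [folklore] -/
theorem static_chain_closes_at_pin (hmono : ∀ u v : ℕ → ℝ, SeqBox γ u → SeqBox γ v → (∀ j, u j ≤ v j) → B u ≤ B v)
    (hL : ∀ k, 0 ≤ L k) (hb : 0 < b) (hlo : ∀ u, SeqBox γ u → b ≤ B u) (hdom : ∀ u, SeqBox γ u → ∑ k ∈ range K, L k * u k ≤ B u)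
    (hh : SeqBox γ h) (hf : MemFlow B gIR h) (m : ℕ) {k : ℕ → ℕ} {x xt Ω ρ : ℕ → ℝ} {θ b' : ℕ → ℕ → ℝ}
    (hk : ∀ i, i < K - 1 → k i = K - 1 - i) (hx : ∀ i, i < K - 1 → x i = L (k i) * (k i) * h (m + k i) ^ 3 / 2)
    (hxt : ∀ i, i < K - 1 → 0 ≤ xt i ∧ xt i ≤ x i)
    (hθ : ∀ i l, l < i → i < K - 1 → 0 ≤ θ i l ∧ θ i l ≤ 1 - ((k l : ℝ) / (k i)) / (((k l : ℝ) / (k i)) + 1) * Real.sqrt (((k l : ℝ) / (k i)) / (((k l : ℝ) / (k i)) + 1)) * Real.exp (-(1 / (2 * ((k l : ℝ) / (k i))))))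
    (hΩ : ∀ i, i < K - 1 → Ω i ≤ ∑ l ∈ range i, x l * (k i : ℝ) / (k l : ℝ))
    (hρ : ∀ i, i < K - 1 → ρ i = xt i * (1 + ∑ l ∈ range i, θ i l * b' i l) / (1 - Ω i))
    (hnew : ∀ i, i < K - 1 → b' (i + 1) i = ρ i / (1 - ρ i)) (hold : ∀ i l, l < i → i < K - 1 → b' (i + 1) l = b' i l / (1 - ρ i)) :
    ∀ i, i < K - 1 → 0 ≤ ρ i ∧ ρ i < 1 :=
  lc_static_closure (M := K - 1) (fun i hi => by rw [hk i hi]; omega) (fun l i hli hi => by rw [hk i hi, hk l (by omega)]; omega) hθ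
    (lc_feasible_at_pin hmono hL hb hlo hdom hh hf m hk hx) hxt hΩ hρ hnew hold

/-- Re-enumeration of the older scales: `{kk < K : k_i < kk} = {k_l : l < i}` for `k_l = K − 1 − l`, so a sum over the older scales is a sum over the
earlier steps of the chain. [folklore] -/
theorem sum_older_eq_sum_steps {k : ℕ → ℕ} (hk : ∀ i, i < K - 1 → k i = K - 1 - i) {i : ℕ} (hi : i < K - 1) (f : ℕ → ℝ) :
    ∑ kk ∈ (range K).filter (k i < ·), f kk = ∑ l ∈ range i, f (k l) := by
  have hset : (range K).filter (k i < ·) = (range i).image (fun l => K - 1 - l) := by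
    ext kk
    simp only [mem_filter, mem_range, mem_image]
    constructor
    · rintro ⟨hkK, hki⟩
      rw [hk i hi] at hki
      exact ⟨K - 1 - kk, by omega, by omega⟩
    · rintro ⟨l, hl, rfl⟩
      rw [hk i hi]
      exact ⟨by omega, by omega⟩
  rw [hset, sum_image fun l hl l' hl' (e : K - 1 - l = K - 1 - l') => by
    have := mem_range.mp hl; have := mem_range.mp hl'; omega]
  exact sum_congr rfl fun l hl => by rw [hk l (by have := mem_range.mp hl; omega)]

/-- **THE FLOW'S STATIC CHAIN CLOSES AT EVERY PIN.**  Same flow, with dampings `1∕(1+F_t) ≤ g_t ≤ 1`; pin `m`; ages oldest first `k_i = K − 1 − i`.  The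
chain's data are the flow's FIRST-ORDER OBJECTS in the letters of (E75a)∕(E75b): the damped young load `x̃ = Σ_l Ky^{(i)}_{m,l}` of the young kernel of age
`k_i`, the old mass inside the young window `Ω = Σ_{kk} Σ_{l<k_i} E^{(i)}_{kk,m,l}` of the read weights of the ages older than `k_i`, and the persistence
defects `θ̂_{k_l}(m;k_i)`.  Then `0 ≤ ρ_i < 1` at every step — by `static_chain_closes_at_pin` and the three orderings (E75a) `young_load_le`,
`window_mass_le_undamped`, (E75b) `defect_le_thetabar` (with (E75a) `defect_nonneg`).  ROUTE (N′) FIRST ORDER: «the static chain closes at every pin» is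
now a theorem about every box solution; what it is FOR — KEY at every age via (E75b) `key_at_pin_of_window_mass_ineq` once the carried ratios bound the
drop ratios ((E71d), modulo MONO′) — is the successor's wiring. [folklore] -/
theorem flow_static_chain_closes_at_pin (hmono : ∀ u v : ℕ → ℝ, SeqBox γ u → SeqBox γ v → (∀ j, u j ≤ v j) → B u ≤ B v)
    (hL : ∀ k, 0 ≤ L k) (hb : 0 < b) (hlo : ∀ u, SeqBox γ u → b ≤ B u) (hdom : ∀ u, SeqBox γ u → ∑ k ∈ range K, L k * u k ≤ B u)
    (hh : SeqBox γ h) (hf : MemFlow B gIR h)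
    (hg : ∀ t, 0 < g t ∧ g t ≤ 1) (hgF : ∀ t, 1 / (1 + ∑ k ∈ range K, L k * h (t + k) ^ 3 / 2) ≤ g t)
    (m : ℕ) {k : ℕ → ℕ} {ρ : ℕ → ℝ} {b' : ℕ → ℕ → ℝ} {Ky θd : ℕ → ℕ → ℕ → ℝ} {E : ℕ → ℕ → ℕ → ℕ → ℝ}
    (hk : ∀ i, i < K - 1 → k i = K - 1 - i)
    (hKy : ∀ i mm l, Ky i mm l = if l < k i then L (k i) * h (mm + k i) ^ 3 / 2 * ∏ t ∈ Ico (mm + 1 + l) (mm + k i + 1), g t else 0)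
    (hE : ∀ i kk mm l, E i kk mm l =
      if k i < kk ∧ kk < K ∧ l < kk then L kk * h (mm + kk) ^ 3 / 2 * ∏ t ∈ Ico (mm + 1 + l) (mm + kk + 1), g t else 0)
    (hθd : ∀ kk mm l, θd kk mm l = 1 - (h (mm + kk + l) / h (mm + kk)) ^ 3 * ∏ t ∈ Ico (mm + kk + 1) (mm + kk + l + 1), g t)
    (hρ : ∀ i, i < K - 1 → ρ i = (∑ l ∈ range K, Ky i m l) * (1 + ∑ l ∈ range i, θd (k l) m (k i) * b' i l) /
      (1 - ∑ kk ∈ range K, ∑ l ∈ (range K).filter (· < k i), E i kk m l))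
    (hnew : ∀ i, i < K - 1 → b' (i + 1) i = ρ i / (1 - ρ i)) (hold : ∀ i l, l < i → i < K - 1 → b' (i + 1) l = b' i l / (1 - ρ i)) :
    ∀ i, i < K - 1 → 0 ≤ ρ i ∧ ρ i < 1 := by
  have hh0 : ∀ n, 0 < h n := fun n => (hh n).1
  have hanti := (strictAnti_of_memFlow hb hlo hh hf).antitone
  have hk1 : ∀ i, i < K - 1 → 1 ≤ k i := fun i hi => by rw [hk i hi]; omega
  refine static_chain_closes_at_pin (x := fun i => L (k i) * (k i) * h (m + k i) ^ 3 / 2) (xt := fun i => ∑ l ∈ range K, Ky i m l)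
    (Ω := fun i => ∑ kk ∈ range K, ∑ l ∈ (range K).filter (· < k i), E i kk m l) (θ := fun i l => θd (k l) m (k i))
    hmono hL hb hlo hdom hh hf m hk (fun _ _ => rfl) ?_ ?_ ?_ hρ hnew hold
  · -- `0 ≤ x̃ ≤ x`: (E75a) `young_weight_nonneg`, `young_load_le`
    intro i _
    exact ⟨sum_nonneg fun l _ => young_weight_nonneg hL hh0 hg (hKy i) m l, young_load_le hL hh0 hg (hKy i) m⟩
  · -- `0 ≤ θ̂ ≤ θ̄`: (E75a) `defect_nonneg`, (E75b) `defect_le_thetabar`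
    intro i l hli hi
    exact ⟨defect_nonneg hh0 hanti hg hθd (k l) m (k i),
      defect_le_thetabar hmono hL hb hlo hdom hh hf hgF hθd m (hk1 l (by omega)) (hk1 i hi)⟩
  · -- `Ω ≤ Ω^u`: (E75a) `window_mass_le_undamped`, re-enumerated over the steps of the chain
    intro i hi
    have h1 := window_mass_le_undamped hL hh0 hg (hE i) m (K := K) (y := k i)
    rw [sum_older_eq_sum_steps hk hi] at h1
    refine h1.trans (le_of_eq (sum_congr rfl fun l _ => ?_))
    have : (k l : ℝ) ≠ 0 := by
      have := hk1 l (by have := mem_range.mp ‹l ∈ range i›; omega); positivity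
    field_simp

/-! ## §3 (append, same generation) The window mass at every pin is below one -/

/-- **THE WINDOW MASS IS BELOW ONE AT EVERY PIN — dominated data.**  Same hypotheses as `static_chain_closes_at_pin`: for every step `i < K − 1`,
`Σ_{l<i} x_l k_i∕k_l < 1` ((E80b) `lc_window_mass_lt_one` on §1's configuration).  Exported for the sandwich wiring (E80d), whose Harnack step divides by
`1 − Ω`. [folklore] -/
theorem window_mass_lt_one_at_pin (hmono : ∀ u v : ℕ → ℝ, SeqBox γ u → SeqBox γ v → (∀ j, u j ≤ v j) → B u ≤ B v)
    (hL : ∀ k, 0 ≤ L k) (hb : 0 < b) (hlo : ∀ u, SeqBox γ u → b ≤ B u) (hdom : ∀ u, SeqBox γ u → ∑ k ∈ range K, L k * u k ≤ B u)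
    (hh : SeqBox γ h) (hf : MemFlow B gIR h) (m : ℕ) {k : ℕ → ℕ} {x xt Ω ρ : ℕ → ℝ} {θ b' : ℕ → ℕ → ℝ}
    (hk : ∀ i, i < K - 1 → k i = K - 1 - i) (hx : ∀ i, i < K - 1 → x i = L (k i) * (k i) * h (m + k i) ^ 3 / 2)
    (hxt : ∀ i, i < K - 1 → 0 ≤ xt i ∧ xt i ≤ x i)
    (hθ : ∀ i l, l < i → i < K - 1 → 0 ≤ θ i l ∧ θ i l ≤ 1 - ((k l : ℝ) / (k i)) / (((k l : ℝ) / (k i)) + 1) * Real.sqrt (((k l : ℝ) / (k i)) / (((k l : ℝ) / (k i)) + 1)) * Real.exp (-(1 / (2 * ((k l : ℝ) / (k i))))))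
    (hΩ : ∀ i, i < K - 1 → Ω i ≤ ∑ l ∈ range i, x l * (k i : ℝ) / (k l : ℝ))
    (hρ : ∀ i, i < K - 1 → ρ i = xt i * (1 + ∑ l ∈ range i, θ i l * b' i l) / (1 - Ω i))
    (hnew : ∀ i, i < K - 1 → b' (i + 1) i = ρ i / (1 - ρ i)) (hold : ∀ i l, l < i → i < K - 1 → b' (i + 1) l = b' i l / (1 - ρ i)) :
    ∀ i, i < K - 1 → ∑ l ∈ range i, x l * (k i : ℝ) / (k l : ℝ) < 1 :=
  lc_window_mass_lt_one (M := K - 1) (fun i hi => by rw [hk i hi]; omega) (fun l i hli hi => by rw [hk i hi, hk l (by omega)]; omega) hθ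
    (lc_feasible_at_pin hmono hL hb hlo hdom hh hf m hk hx) hxt hΩ hρ hnew hold

/-- **THE FLOW'S OLD MASS INSIDE THE YOUNG WINDOW IS BELOW ONE AT EVERY PIN.**  Same hypotheses as `flow_static_chain_closes_at_pin`: for every step `i < K − 1`
(young age `k_i`), `Ω_m = Σ_{kk}Σ_{l<k_i}E^{(i)}_{kk,m,l} < 1` — (E75a) `window_mass_le_undamped` and `window_mass_lt_one_at_pin`. [folklore] -/
theorem flow_window_mass_lt_one_at_pin (hmono : ∀ u v : ℕ → ℝ, SeqBox γ u → SeqBox γ v → (∀ j, u j ≤ v j) → B u ≤ B v)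
    (hL : ∀ k, 0 ≤ L k) (hb : 0 < b) (hlo : ∀ u, SeqBox γ u → b ≤ B u) (hdom : ∀ u, SeqBox γ u → ∑ k ∈ range K, L k * u k ≤ B u)
    (hh : SeqBox γ h) (hf : MemFlow B gIR h)
    (hg : ∀ t, 0 < g t ∧ g t ≤ 1) (hgF : ∀ t, 1 / (1 + ∑ k ∈ range K, L k * h (t + k) ^ 3 / 2) ≤ g t)
    (m : ℕ) {k : ℕ → ℕ} {ρ : ℕ → ℝ} {b' : ℕ → ℕ → ℝ} {Ky θd : ℕ → ℕ → ℕ → ℝ} {E : ℕ → ℕ → ℕ → ℕ → ℝ}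
    (hk : ∀ i, i < K - 1 → k i = K - 1 - i)
    (hKy : ∀ i mm l, Ky i mm l = if l < k i then L (k i) * h (mm + k i) ^ 3 / 2 * ∏ t ∈ Ico (mm + 1 + l) (mm + k i + 1), g t else 0)
    (hE : ∀ i kk mm l, E i kk mm l =
      if k i < kk ∧ kk < K ∧ l < kk then L kk * h (mm + kk) ^ 3 / 2 * ∏ t ∈ Ico (mm + 1 + l) (mm + kk + 1), g t else 0)
    (hθd : ∀ kk mm l, θd kk mm l = 1 - (h (mm + kk + l) / h (mm + kk)) ^ 3 * ∏ t ∈ Ico (mm + kk + 1) (mm + kk + l + 1), g t)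
    (hρ : ∀ i, i < K - 1 → ρ i = (∑ l ∈ range K, Ky i m l) * (1 + ∑ l ∈ range i, θd (k l) m (k i) * b' i l) /
      (1 - ∑ kk ∈ range K, ∑ l ∈ (range K).filter (· < k i), E i kk m l))
    (hnew : ∀ i, i < K - 1 → b' (i + 1) i = ρ i / (1 - ρ i)) (hold : ∀ i l, l < i → i < K - 1 → b' (i + 1) l = b' i l / (1 - ρ i)) :
    ∀ i, i < K - 1 → ∑ kk ∈ range K, ∑ l ∈ (range K).filter (· < k i), E i kk m l < 1 := by
  have hh0 : ∀ n, 0 < h n := fun n => (hh n).1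
  have hanti := (strictAnti_of_memFlow hb hlo hh hf).antitone
  have hk1 : ∀ i, i < K - 1 → 1 ≤ k i := fun i hi => by rw [hk i hi]; omega
  have hΩu := window_mass_lt_one_at_pin (x := fun i => L (k i) * (k i) * h (m + k i) ^ 3 / 2) (xt := fun i => ∑ l ∈ range K, Ky i m l)
    (Ω := fun i => ∑ kk ∈ range K, ∑ l ∈ (range K).filter (· < k i), E i kk m l) (θ := fun i l => θd (k l) m (k i))
    hmono hL hb hlo hdom hh hf m hk (fun _ _ => rfl) ?_ ?_ ?_ hρ hnew hold
  · intro i hi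
    have h1 := window_mass_le_undamped hL hh0 hg (hE i) m (K := K) (y := k i)
    rw [sum_older_eq_sum_steps hk hi] at h1
    refine h1.trans_lt ((le_of_eq (sum_congr rfl fun l _ => ?_)).trans_lt (hΩu i hi))
    have : (k l : ℝ) ≠ 0 := by
      have := hk1 l (by have := mem_range.mp ‹l ∈ range i›; omega); positivity
    field_simp
  · intro i _
    exact ⟨sum_nonneg fun l _ => young_weight_nonneg hL hh0 hg (hKy i) m l, young_load_le hL hh0 hg (hKy i) m⟩
  · intro i l hli hi
    exact ⟨defect_nonneg hh0 hanti hg hθd (k l) m (k i),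
      defect_le_thetabar hmono hL hb hlo hdom hh hf hgF hθd m (hk1 l (by omega)) (hk1 i hi)⟩
  · intro i hi
    have h1 := window_mass_le_undamped hL hh0 hg (hE i) m (K := K) (y := k i)
    rw [sum_older_eq_sum_steps hk hi] at h1
    refine h1.trans (le_of_eq (sum_congr rfl fun l _ => ?_))
    have : (k l : ℝ) ≠ 0 := by
      have := hk1 l (by have := mem_range.mp ‹l ∈ range i›; omega); positivity
    field_simp

end Summit.QuantumFields.BalabanUV.Beta.EriceRemainderEnclosureHistoryAutonomyComparisonAgeCompositionStaticChainClosureAtPin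

end
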